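import Mathlib
import Summits.ValiantsHypothesis.ValiantsHypothesis.Theorems.BarrierLeverPartitionMinorsHitByVPHiddenStatesCoStarAffine

/-!
# Route BarrierLever — item `PartitionMinorsHitByVP` (stmt-ValiantsHypothesis-19717), line `hidden-states`:
# CO-STARS, three missing rows — the node at `r = 2^h − 3` for EVERY `h ≥ 2`, one piece, all injective row families

Helper file (`--supports stmt-ValiantsHypothesis-19717`; cell valiant-natproofs, rung V4, 𝒟-side door (c); prover seat val-np-p6 gen 10).
Definition-free; closes NO item. Three distinct 0/1 points are never collinear, hence affinely independent; so `CoStar.coStar_exists_table_of_indep`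
(`…CoStarAffine`, p615482) applies to EVERY injective family of size `2^h − 3`:

* `coStar_exists_table_triple` — the co-star «all state sets except the top and two co-singletons» serves every injective `u` of size `2^h − 3`
  (witness coordinates: `a₀` separating two of the missing sets, `a₁` separating the two that agree at `a₀`; the `3 × 3` matrix `[𝟙; χ_{a₀}; χ_{a₁}]`
  is then nonsingular by an eight-case check);
* **`universalJoinWide_top_three`** — for `h ≥ 2` and `r = 2^h − 3` the body of `Stmt.stub_universalJoinWide` holds with ONE legal piece (K = h;
  weight 1 on the two special states, 2 elsewhere), for ALL injective `u`.

With p614189 (`r = 2^h − 1`) and `…CoStarNode` (`r = 2^h − 2`) the top THREE sizes of every `h` are cells of the node served by a single universal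
co-star — the permutation-table frontier (four missing sets can form an affine square). WHAT THIS IS NOT: nothing on crux 14610 or VP ≠ VNP.
-/

set_option linter.dupNamespace false

namespace Summit.ValiantsHypothesis.ValiantsHypothesis.Theorems.BarrierLever.HiddenStates

open Finset Matrix

noncomputable section

namespace CoStar

variable {h : ℕ}

/-- The `3 × 3` pattern check (A): `det [1 1 1; p₀ p₁ p₂; t₀ t₁ t₂] ≠ 0` for indicator rows with `p₀ ≠ p₁`, `p₀ = p₂`, `t₀ ≠ t₂`. -/
theorem det_three_pattern_ne_zero (P₀ P₁ P₂ T₀ T₁ T₂ : Prop) [Decidable P₀] [Decidable P₁] [Decidable P₂]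
    [Decidable T₀] [Decidable T₁] [Decidable T₂] (h01 : ¬ (P₀ ↔ P₁)) (h02 : (P₀ ↔ P₂)) (ht : ¬ (T₀ ↔ T₂)) :
    !![(1 : ℂ), 1, 1; (if P₀ then 1 else 0), (if P₁ then 1 else 0), (if P₂ then 1 else 0);
      (if T₀ then 1 else 0), (if T₁ then 1 else 0), (if T₂ then 1 else 0)].det ≠ 0 := by
  rw [Matrix.det_fin_three]
  simp only [Matrix.of_apply, Matrix.cons_val', Matrix.cons_val_zero, Matrix.cons_val_one, Matrix.cons_val_two,
    Matrix.empty_val', Matrix.cons_val_fin_one]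
  revert h01 h02 ht
  by_cases p0 : P₀ <;> by_cases p1 : P₁ <;> by_cases p2 : P₂ <;> by_cases t0 : T₀ <;> by_cases t1 : T₁ <;> by_cases t2 : T₂ <;>
    norm_num [p0, p1, p2, t0, t1, t2]

/-- The `3 × 3` pattern check (B): `p₀ ≠ p₁`, `p₁ = p₂`, `t₁ ≠ t₂`. -/
theorem det_three_pattern_ne_zero' (P₀ P₁ P₂ T₀ T₁ T₂ : Prop) [Decidable P₀] [Decidable P₁] [Decidable P₂]
    [Decidable T₀] [Decidable T₁] [Decidable T₂] (h01 : ¬ (P₀ ↔ P₁)) (h12 : (P₁ ↔ P₂)) (ht : ¬ (T₁ ↔ T₂)) :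
    !![(1 : ℂ), 1, 1; (if P₀ then 1 else 0), (if P₁ then 1 else 0), (if P₂ then 1 else 0);
      (if T₀ then 1 else 0), (if T₁ then 1 else 0), (if T₂ then 1 else 0)].det ≠ 0 := by
  rw [Matrix.det_fin_three]
  simp only [Matrix.of_apply, Matrix.cons_val', Matrix.cons_val_zero, Matrix.cons_val_one, Matrix.cons_val_two,
    Matrix.empty_val', Matrix.cons_val_fin_one]
  revert h01 h12 ht
  by_cases p0 : P₀ <;> by_cases p1 : P₁ <;> by_cases p2 : P₂ <;> by_cases t0 : T₀ <;> by_cases t1 : T₁ <;> by_cases t2 : T₂ <;>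
    norm_num [p0, p1, p2, t0, t1, t2]

/-- **Any THREE missing rows.** The co-star with two missing co-singletons (`q₀ ≠ q₁`) serves every injective family of size `2^h − 3`. -/
theorem coStar_exists_table_triple {r m : ℕ} (p₀ : Fin m) (u : Fin r → Finset (Fin h)) (hu : Function.Injective u)
    (hr : r + 3 = 2 ^ h) (c : Fin r → Finset (Fin h)) (hc : Function.Injective c) (q₀ q₁ : Fin h) (hq : q₀ ≠ q₁)
    (hcu : ∀ k, c k ≠ Finset.univ) (hc0 : ∀ k, c k ≠ Finset.univ.erase q₀) (hc1 : ∀ k, c k ≠ Finset.univ.erase q₁) :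
    ∃ tx : Fin m → Option (Fin h) → Fin h → ℂ,
      (Matrix.of fun i k : Fin r =>
        ∏ x ∈ u i, (tx p₀ none x + ∑ q ∈ c k, tx p₀ (some q) x)).det ≠ 0 := by
  classical
  -- the three missing rows, enumerated
  set T : Finset (Finset (Fin h)) := Finset.univ \ Finset.univ.image u with hT
  have hmiss : T.card = 3 := by
    rw [hT, Finset.card_sdiff_of_subset (Finset.subset_univ _), Finset.card_univ, Fintype.card_finset, Fintype.card_fin,
      Finset.card_image_of_injective _ hu, Finset.card_univ, Fintype.card_fin]
    omega
  let ε : {x // x ∈ T} ≃ Fin 3 := (Finset.equivFin T).trans (finCongr hmiss)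
  let s : Fin 3 → Finset (Fin h) := fun l => (ε.symm l).1
  have hs : Function.Injective s := fun l l' hll => ε.symm.injective (Subtype.ext hll)
  have hus : ∀ i l, u i ≠ s l := by
    intro i l hil
    have hmem : s l ∈ T := (ε.symm l).2
    rw [hT, Finset.mem_sdiff] at hmem
    exact hmem.2 (Finset.mem_image.mpr ⟨i, Finset.mem_univ _, hil⟩)
  have h01 : s 0 ≠ s 1 := fun hh => by have := hs hh; exact absurd this (by decide)
  have h02 : s 0 ≠ s 2 := fun hh => by have := hs hh; exact absurd this (by decide)
  have h12 : s 1 ≠ s 2 := fun hh => by have := hs hh; exact absurd this (by decide)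
  -- two distinct values give an injective `Fin 2`-family (cf. `injective_vecCons_pair` in the Literature tree)
  have hinj2 : ∀ {x y : Fin h}, x ≠ y → Function.Injective ![x, y] := by
    intro x y hxy i j hij
    fin_cases i <;> fin_cases j
    · rfl
    · exact absurd (by simpa using hij) hxy
    · exact absurd (by simpa using hij.symm) hxy
    · rfl
  have hqs : Function.Injective ![q₀, q₁] := hinj2 hq
  have hcq : ∀ k (j : Fin 2), c k ≠ Finset.univ.erase ((![q₀, q₁] : Fin 2 → Fin h) j) := by
    intro k j
    fin_cases j
    · simpa using hc0 k
    · simpa using hc1 k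
  -- a coordinate separating s 0 and s 1
  obtain ⟨a₀, ha₀⟩ : ∃ a₀ : Fin h, ¬ (a₀ ∈ s 0 ↔ a₀ ∈ s 1) := by
    by_contra hall; push Not at hall; exact h01 (Finset.ext hall)
  -- the matrix of the affine-independence witness, made explicit
  have hM : ∀ a₁ : Fin h, (Matrix.of fun l i : Fin (2 + 1) =>
      (Fin.cases (1 : ℂ) (fun j => if (![a₀, a₁] : Fin 2 → Fin h) j ∈ s i then 1 else 0) l : ℂ))
      = !![(1 : ℂ), 1, 1; (if a₀ ∈ s 0 then 1 else 0), (if a₀ ∈ s 1 then 1 else 0), (if a₀ ∈ s 2 then 1 else 0);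
          (if a₁ ∈ s 0 then 1 else 0), (if a₁ ∈ s 1 then 1 else 0), (if a₁ ∈ s 2 then 1 else 0)] := by
    intro a₁
    ext l i
    fin_cases l <;> fin_cases i <;> rfl
  by_cases h2 : (a₀ ∈ s 0 ↔ a₀ ∈ s 2)
  · -- s 0 and s 2 agree at a₀: separate them by a₁
    obtain ⟨a₁, ha₁⟩ : ∃ a₁ : Fin h, ¬ (a₁ ∈ s 0 ↔ a₁ ∈ s 2) := by
      by_contra hall; push Not at hall; exact h02 (Finset.ext hall)
    have ha01 : a₀ ≠ a₁ := by rintro rfl; exact ha₁ h2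
    refine coStar_exists_table_of_indep p₀ u hu s hs hus hr c hc ![q₀, q₁] hqs hcu hcq ![a₀, a₁]
      (hinj2 ha01) ?_
    rw [hM a₁]
    exact det_three_pattern_ne_zero _ _ _ _ _ _ ha₀ h2 ha₁
  · -- s 1 and s 2 agree at a₀: separate them by a₁
    have h12' : (a₀ ∈ s 1 ↔ a₀ ∈ s 2) := by tauto
    obtain ⟨a₁, ha₁⟩ : ∃ a₁ : Fin h, ¬ (a₁ ∈ s 1 ↔ a₁ ∈ s 2) := by
      by_contra hall; push Not at hall; exact h12 (Finset.ext hall)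
    have ha01 : a₀ ≠ a₁ := by rintro rfl; exact ha₁ h12'
    refine coStar_exists_table_of_indep p₀ u hu s hs hus hr c hc ![q₀, q₁] hqs hcu hcq ![a₀, a₁]
      (hinj2 ha01) ?_
    rw [hM a₁]
    exact det_three_pattern_ne_zero' _ _ _ _ _ _ ha₀ h12' ha₁

/-- **The conjecture node at `r = 2^h − 3`, for every `h ≥ 2`, with one piece.** -/
theorem universalJoinWide_top_three (h : ℕ) (h2 : 2 ≤ h) (r : ℕ) (hr : r + 3 = 2 ^ h) :
    ∃ (m K : ℕ) (W : Fin m → ℕ) (wt : Fin m → Fin K → ℕ) (e : Fin r → Fin m × Finset (Fin K)),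
      m ≤ h + h ∧ K ≤ h * h * h ∧ Function.Injective e ∧
      (∀ x : Fin m × Finset (Fin K), x ∉ Set.range e →
        ∀ i, W (e i).1 + ∑ k ∈ (e i).2, wt (e i).1 k < W x.1 + ∑ k ∈ x.2, wt x.1 k) ∧
      ∀ u : Fin r → Finset (Fin h), Function.Injective u →
        ∃ tx : Fin m → Option (Fin K) → Fin h → ℂ,
          (Matrix.of fun i k : Fin r =>
            ∏ a ∈ u i, (tx (e k).1 none a + ∑ q ∈ (e k).2, tx (e k).1 (some q) a)).det ≠ 0 := by
  classical
  have h1 : 1 ≤ h := by omega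
  let q₀ : Fin h := ⟨0, h1⟩
  let q₁ : Fin h := ⟨1, h2⟩
  have hq : q₀ ≠ q₁ := by intro hh; have := congrArg Fin.val hh; simp [q₀, q₁] at this
  -- members: all subsets except `univ`, `univ.erase q₀`, `univ.erase q₁`
  set D : Finset (Finset (Fin h)) :=
    ((Finset.univ.erase Finset.univ).erase (Finset.univ.erase q₀)).erase (Finset.univ.erase q₁) with hD
  have hne0 : (Finset.univ : Finset (Fin h)).erase q₀ ≠ Finset.univ := by
    intro hh; have := Finset.mem_univ q₀; rw [← hh] at this; exact Finset.notMem_erase q₀ _ this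
  have hne1 : (Finset.univ : Finset (Fin h)).erase q₁ ≠ Finset.univ := by
    intro hh; have := Finset.mem_univ q₁; rw [← hh] at this; exact Finset.notMem_erase q₁ _ this
  have hne01 : (Finset.univ : Finset (Fin h)).erase q₁ ≠ Finset.univ.erase q₀ := by
    intro hh
    have : q₀ ∈ (Finset.univ : Finset (Fin h)).erase q₁ := Finset.mem_erase.mpr ⟨hq, Finset.mem_univ _⟩
    rw [hh] at this
    exact Finset.notMem_erase q₀ _ this
  have hDcard : D.card = r := by
    rw [hD, Finset.card_erase_of_mem, Finset.card_erase_of_mem, Finset.card_erase_of_mem (Finset.mem_univ _),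
      Finset.card_univ, Fintype.card_finset, Fintype.card_fin]
    · omega
    · rw [Finset.mem_erase]; exact ⟨hne0, Finset.mem_univ _⟩
    · rw [Finset.mem_erase, Finset.mem_erase]; exact ⟨hne01, hne1, Finset.mem_univ _⟩
  let ε : {x // x ∈ D} ≃ Fin r := (Finset.equivFin D).trans (finCongr hDcard)
  let c : Fin r → Finset (Fin h) := fun k => (ε.symm k).1
  have hc : Function.Injective c := fun k k' hkk => ε.symm.injective (Subtype.ext hkk)
  have hcmem : ∀ k, c k ∈ D := fun k => (ε.symm k).2
  have hcu : ∀ k, c k ≠ Finset.univ := by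
    intro k hk; have h2' := hcmem k
    rw [hD, Finset.mem_erase, Finset.mem_erase, Finset.mem_erase] at h2'
    exact h2'.2.2.1 hk
  have hc0 : ∀ k, c k ≠ Finset.univ.erase q₀ := by
    intro k hk; have h2' := hcmem k
    rw [hD, Finset.mem_erase, Finset.mem_erase] at h2'
    exact h2'.2.1 hk
  have hc1 : ∀ k, c k ≠ Finset.univ.erase q₁ := by
    intro k hk; have h2' := hcmem k
    rw [hD, Finset.mem_erase] at h2'
    exact h2'.1 hk
  have hcsurj : ∀ J, J ≠ Finset.univ → J ≠ Finset.univ.erase q₀ → J ≠ Finset.univ.erase q₁ → ∃ k, c k = J := by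
    intro J hJ hJ0 hJ1
    have hJD : J ∈ D := by
      rw [hD, Finset.mem_erase, Finset.mem_erase, Finset.mem_erase]
      exact ⟨hJ1, hJ0, hJ, Finset.mem_univ _⟩
    exact ⟨ε ⟨J, hJD⟩, by simp [c]⟩
  -- weights: 1 on q₀, q₁; 2 elsewhere
  refine ⟨1, h, fun _ => 0, fun _ q => if q = q₀ ∨ q = q₁ then 1 else 2, fun k => ((0 : Fin 1), c k), by omega,
    le_trans (Nat.le_mul_of_pos_right h h1) (Nat.le_mul_of_pos_right _ h1), ?_, ?_, ?_⟩
  · intro k k' hkk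
    exact hc (congrArg Prod.snd hkk)
  · -- legality: members weigh ≤ 2h − 4, the three non-members weigh ≥ 2h − 3
    intro x hx i
    have hx2 : x.2 = Finset.univ ∨ x.2 = Finset.univ.erase q₀ ∨ x.2 = Finset.univ.erase q₁ := by
      by_contra hno
      push Not at hno
      obtain ⟨k, hk⟩ := hcsurj x.2 hno.1 hno.2.1 hno.2.2
      apply hx
      refine ⟨k, ?_⟩
      ext1
      · exact Subsingleton.elim _ _
      · exact hk
    -- weight identity: Σ_{q∈J} w q + [q₀ ∈ J] + [q₁ ∈ J] = 2|J|
    have hwt : ∀ J : Finset (Fin h), ∑ q ∈ J, (if q = q₀ ∨ q = q₁ then 1 else 2)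
        + (if q₀ ∈ J then 1 else 0) + (if q₁ ∈ J then 1 else 0) = 2 * J.card := by
      intro J
      have hsum : ∑ q ∈ J, (if q = q₀ ∨ q = q₁ then 1 else 2)
          = ∑ q ∈ J, (2 - ((if q = q₀ then 1 else 0) + (if q = q₁ then 1 else 0))) := by
        refine Finset.sum_congr rfl fun q _ => ?_
        by_cases hq0 : q = q₀
        · subst hq0; rw [if_pos (Or.inl rfl), if_pos rfl, if_neg hq]
        · by_cases hq1 : q = q₁
          · subst hq1; rw [if_pos (Or.inr rfl), if_neg hq0, if_pos rfl]
          · rw [if_neg (by tauto), if_neg hq0, if_neg hq1]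
      have hle : ∀ q ∈ J, ((if q = q₀ then 1 else 0) + (if q = q₁ then 1 else 0)) ≤ 2 := by
        intro q _; split_ifs <;> omega
      rw [hsum, Finset.sum_tsub_distrib _ hle, Finset.sum_const, smul_eq_mul, Finset.sum_add_distrib,
        Finset.sum_ite_eq' J q₀, Finset.sum_ite_eq' J q₁]
      have h3 : (if q₀ ∈ J then 1 else 0) + (if q₁ ∈ J then 1 else 0) ≤ J.card * 2 := by
        by_cases hq0 : q₀ ∈ J
        · have : 1 ≤ J.card := Finset.card_pos.mpr ⟨q₀, hq0⟩
          split_ifs <;> omega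
        · by_cases hq1 : q₁ ∈ J
          · have : 1 ≤ J.card := Finset.card_pos.mpr ⟨q₁, hq1⟩
            rw [if_neg hq0, if_pos hq1]; omega
          · rw [if_neg hq0, if_neg hq1]; omega
      omega
    have hmem_wt : ∑ q ∈ c i, (if q = q₀ ∨ q = q₁ then 1 else 2) + 4 ≤ 2 * h := by
      have hlt : c i ⊂ Finset.univ := Finset.ssubset_univ_iff.mpr (hcu i)
      have hcard := Finset.card_lt_card hlt
      rw [Finset.card_univ, Fintype.card_fin] at hcard
      have := hwt (c i)
      by_cases hsmall : (c i).card + 2 ≤ h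
      · split_ifs at this <;> omega
      · have hcard' : (c i).card = h - 1 := by omega
        -- then both q₀ and q₁ lie in c i
        have hq0 : q₀ ∈ c i := by
          by_contra hq0
          apply hc0 i
          apply Finset.eq_of_subset_of_card_le
          · intro y hy; rw [Finset.mem_erase]; exact ⟨fun hh => hq0 (hh ▸ hy), Finset.mem_univ _⟩
          · rw [Finset.card_erase_of_mem (Finset.mem_univ _), Finset.card_univ, Fintype.card_fin, hcard']
        have hq1 : q₁ ∈ c i := by
          by_contra hq1
          apply hc1 i
          apply Finset.eq_of_subset_of_card_le
          · intro y hy; rw [Finset.mem_erase]; exact ⟨fun hh => hq1 (hh ▸ hy), Finset.mem_univ _⟩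
          · rw [Finset.card_erase_of_mem (Finset.mem_univ _), Finset.card_univ, Fintype.card_fin, hcard']
        rw [if_pos hq0, if_pos hq1] at this
        omega
    have hx_wt : 2 * h ≤ ∑ q ∈ x.2, (if q = q₀ ∨ q = q₁ then 1 else 2) + 3 := by
      have := hwt x.2
      rcases hx2 with hx2 | hx2 | hx2 <;> rw [hx2] at this ⊢
      · rw [if_pos (Finset.mem_univ _), if_pos (Finset.mem_univ _), Finset.card_univ, Fintype.card_fin] at this; omega
      · rw [if_neg (Finset.notMem_erase q₀ _), if_pos (Finset.mem_erase.mpr ⟨hq.symm, Finset.mem_univ _⟩),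
          Finset.card_erase_of_mem (Finset.mem_univ _), Finset.card_univ, Fintype.card_fin] at this; omega
      · rw [if_pos (Finset.mem_erase.mpr ⟨hq, Finset.mem_univ _⟩), if_neg (Finset.notMem_erase q₁ _),
          Finset.card_erase_of_mem (Finset.mem_univ _), Finset.card_univ, Fintype.card_fin] at this; omega
    show 0 + ∑ q ∈ c i, (if q = q₀ ∨ q = q₁ then 1 else 2) < 0 + ∑ q ∈ x.2, (if q = q₀ ∨ q = q₁ then 1 else 2)
    omega
  · intro u hu
    exact coStar_exists_table_triple (0 : Fin 1) u hu hr c hc q₀ q₁ hq hcu hc0 hc1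

end CoStar

end

end Summit.ValiantsHypothesis.ValiantsHypothesis.Theorems.BarrierLever.HiddenStates
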